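import Mathlib.Algebra.Polynomial.Expand
import Mathlib.Algebra.Polynomial.Div
import Mathlib.Algebra.Polynomial.Inductions
import Mathlib.Algebra.Polynomial.Degree.SmallDegree
import Mathlib.RingTheory.Polynomial.Basic
import Mathlib.RingTheory.FiniteType
import Mathlib.RingTheory.Ideal.Quotient.Operations
import Mathlib.RingTheory.Ideal.Quotient.Noetherian
import Mathlib.RingTheory.Ideal.Maps
import HarnessLib

/-!
# The cusp-cylinder `R = k[x,y,z]/(y² - x³)` (supporting constructions for `StubCaSheafFalse`)

Negative-lemma chain for crux `Globalisation` (stmt-ResolutionOfSingularities-16486), file 2/6.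
`P = k[z][x][y]`, `B = k[z][t]`, `θ : P → B` (`x ↦ t²`, `y ↦ t³`, `z ↦ z`), `f = y² - x³`;
`ker θ = (f)` (division by the monic `f` and parity of `t`-exponents), so `R := P ⧸ ker θ ≅ k[t²,t³,z]`
is a finitely generated domain with an embedding `ι : R ↪ k[z][t]` whose image is
`{b : b.coeff 1 = 0}` (`exists_θ_eq_of_coeff_one`); `U = {s : (ι s)(t=0) ≠ 0} = R ∖ (x, y)`.
-/

set_option linter.dupNamespace false

-- nested polynomial rings (`k[z][x][y]`) need nested instance synthesis during unification
set_option maxSynthPendingDepth 3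

noncomputable section

namespace Summit.ResolutionOfSingularities.ResolutionOfSingularities.Theorems.Globalisation.Negative

open Polynomial

open Polynomial

namespace CuspCylinder

variable (k : Type) [Field k]

/-- `B = k[z][t]` (outer variable `t`, coefficients in `k[z]`). -/
abbrev B := Polynomial (Polynomial k)

/-- `P = k[z][x][y]` (outer variable `y`, then `x`, coefficients in `k[z]`). -/
abbrev P := Polynomial (Polynomial (Polynomial k))

/-- Shortcut instance: the nested polynomial ring `k[z][x][y]` is a commutative ring (speeds up and unblocks nested instance synthesis). -/
instance : CommRing (P k) := inferInstance

/-- `θ₂ : k[z][x] → k[z][t]`, `x ↦ t²` (the Frobenius-free `expand 2`). -/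
def θ₂ : B k →+* B k := (expand (Polynomial k) 2 : B k →ₐ[Polynomial k] B k).toRingHom

/-- `θ : k[z][x][y] → k[z][t]`, `x ↦ t²`, `y ↦ t³`, `z ↦ z`. -/
def θ : P k →+* B k := eval₂RingHom (θ₂ k) (X ^ 3)

/-- `f = y² - x³`. -/
def f : P k := X ^ 2 - C (X ^ 3)

/-- Unfolding of `θ₂ = expand 2`. -/
@[simp] theorem θ₂_apply (q : B k) : θ₂ k q = expand (Polynomial k) 2 q := rfl

/-- `θ` on `y`-constants: `q(x, z) ↦ q(t², z)`. -/
@[simp] theorem θ_C (q : B k) : θ k (C q) = expand (Polynomial k) 2 q := by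
  simp [θ]

/-- `θ y = t³`. -/
@[simp] theorem θ_X : θ k X = X ^ 3 := by
  simp [θ]

/-- `θ (y² - x³) = t⁶ - t⁶ = 0`. -/
theorem θ_f : θ k (f k) = 0 := by
  rw [f, map_sub, map_pow, θ_X, θ_C, map_pow, expand_X]
  ring

/-- `f = y² - x³` is monic in `y`. -/
theorem f_monic : (f k).Monic := by
  unfold f
  exact monic_X_pow_sub_C _ two_ne_zero

/-- `expand 2` doubles exponents: the even coefficients of `q(t²)` are those of `q`. -/
theorem coeff_expand_two_even (q : B k) (i : ℕ) :
    (expand (Polynomial k) 2 q).coeff (2 * i) = q.coeff i := by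
  rw [mul_comm, coeff_expand_mul two_pos]

/-- `expand 2` doubles exponents: the odd coefficients of `q(t²)` vanish. -/
theorem coeff_expand_two_odd (q : B k) (i : ℕ) :
    (expand (Polynomial k) 2 q).coeff (2 * i + 1) = 0 := by
  rw [coeff_expand two_pos]
  have : ¬ 2 ∣ 2 * i + 1 := by omega
  simp [this]

/-- `deg_y f = 2`. -/
theorem natDegree_f : (f k).natDegree = 2 := by
  unfold f
  exact natDegree_X_pow_sub_C

/-- `f ≠ 1`. -/
theorem f_ne_one : f k ≠ 1 := by
  intro h
  have := natDegree_f k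
  rw [h, natDegree_one] at this
  exact absurd this (by norm_num)

/-- If `θ r = 0` and `deg_y r ≤ 1` then `r = 0` (parity of `t`-exponents). -/
theorem eq_zero_of_θ_eq_zero_of_natDegree_le_one (r : P k) (hdeg : r.natDegree ≤ 1)
    (hθr : θ k r = 0) : r = 0 := by
  have hr1 : r = C (r.coeff 1) * X + C (r.coeff 0) := eq_X_add_C_of_natDegree_le_one hdeg
  have key : expand (Polynomial k) 2 (r.coeff 1) * X ^ 3 + expand (Polynomial k) 2 (r.coeff 0) = 0 := by
    rw [hr1] at hθr
    simpa using hθr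
  have h0 : r.coeff 0 = 0 := by
    refine Polynomial.ext fun i => ?_
    have hi := congrArg (fun b : B k => b.coeff (2 * i)) key
    simp only [coeff_add, coeff_zero, coeff_mul_X_pow', coeff_expand_two_even] at hi
    split_ifs at hi with h3
    · obtain ⟨i', rfl⟩ : ∃ i', i = i' + 2 := ⟨i - 2, by omega⟩
      have : 2 * (i' + 2) - 3 = 2 * i' + 1 := by omega
      rw [this, coeff_expand_two_odd, zero_add] at hi
      simpa using hi
    · simpa using hi
  have h1 : r.coeff 1 = 0 := by
    refine Polynomial.ext fun i => ?_
    have hi := congrArg (fun b : B k => b.coeff (2 * i + 3)) key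
    simp only [coeff_add, coeff_zero, coeff_mul_X_pow'] at hi
    rw [if_pos (by omega)] at hi
    have e1 : 2 * i + 3 - 3 = 2 * i := by omega
    have e2 : 2 * i + 3 = 2 * (i + 1) + 1 := by ring
    rw [e1, coeff_expand_two_even, e2, coeff_expand_two_odd, add_zero] at hi
    simpa using hi
  rw [hr1, h0, h1]
  simp

/-- `θ q = 0 ↔ f ∣ q`. -/
theorem θ_eq_zero_iff (q : P k) : θ k q = 0 ↔ f k ∣ q := by
  constructor
  · intro hq
    have hqr : q %ₘ f k + f k * (q /ₘ f k) = q := modByMonic_add_div q (f k)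
    have hdeg : (q %ₘ f k).natDegree ≤ 1 := by
      have h := natDegree_modByMonic_lt q (f_monic k) (f_ne_one k)
      rw [natDegree_f] at h
      omega
    have hθr : θ k (q %ₘ f k) = 0 := by
      have := congrArg (θ k) hqr
      rw [map_add, map_mul, θ_f, zero_mul, add_zero] at this
      rw [this, hq]
    have hr0 := eq_zero_of_θ_eq_zero_of_natDegree_le_one k _ hdeg hθr
    rw [hr0, zero_add] at hqr
    exact ⟨q /ₘ f k, hqr.symm⟩
  · rintro ⟨n, rfl⟩
    rw [map_mul, θ_f, zero_mul]

/-- The kernel of `θ` is generated by `f = y² - x³`. -/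
theorem ker_θ : RingHom.ker (θ k) = Ideal.span {f k} := by
  ext q
  rw [RingHom.mem_ker, θ_eq_zero_iff]
  exact Ideal.mem_span_singleton.symm

/-- Every element of `k[z][t]` is, up to its `t¹`-term, in the image of `θ`
(`k[t², t³, z] = {b : b.coeff 1 = 0}`). -/
theorem exists_θ_eq (b : B k) : ∃ q : P k, θ k q = b - monomial 1 (b.coeff 1) := by
  induction b using Polynomial.induction_on' with
  | add b b' hb hb' =>
    obtain ⟨q, hq⟩ := hb
    obtain ⟨q', hq'⟩ := hb'
    refine ⟨q + q', ?_⟩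
    rw [map_add, hq, hq', coeff_add, map_add]
    ring
  | monomial n a =>
    rw [coeff_monomial]
    by_cases hn : n = 1
    · subst hn
      exact ⟨0, by simp⟩
    · rw [if_neg hn, map_zero, sub_zero]
      obtain ⟨i, rfl | rfl⟩ := Nat.even_or_odd' n
      · exact ⟨C (monomial i a), by rw [θ_C, expand_monomial, mul_comm]⟩
      · obtain ⟨i', rfl⟩ : ∃ i', i = i' + 1 := ⟨i - 1, by omega⟩
        refine ⟨C (monomial i' a) * X, ?_⟩
        rw [map_mul, θ_C, θ_X, expand_monomial, monomial_mul_X_pow]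
        have e : i' * 2 + 3 = 2 * (i' + 1) + 1 := by ring
        rw [e]

/-- An element of `k[z][t]` with no `t¹`-term lies in the image of `θ` (`θ(P) = k[t², t³, z]`). -/
theorem exists_θ_eq_of_coeff_one (b : B k) (hb : b.coeff 1 = 0) : ∃ q : P k, θ k q = b := by
  obtain ⟨q, hq⟩ := exists_θ_eq k b
  exact ⟨q, by rw [hq, hb]; simp⟩

/-- `(θ q)(t = 0) = q(x = 0, y = 0)`: the constant coefficient of `θ q` in `t` is the constant
coefficient (in `x`) of the constant coefficient (in `y`) of `q`. -/
theorem coeff_zero_θ (q : P k) : (θ k q).coeff 0 = (q.coeff 0).coeff 0 := by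
  have h : (constantCoeff : B k →+* Polynomial k).comp (θ k) =
      (constantCoeff : B k →+* Polynomial k).comp (constantCoeff : P k →+* B k) := by
    apply Polynomial.ringHom_ext
    · intro a
      simp only [RingHom.comp_apply, θ_C, constantCoeff_apply, coeff_C_zero]
      simpa using coeff_expand_two_even k a 0
    · simp [θ_X]
  simpa using congrArg (fun φ => φ q) h

/-! ## The ring `R` -/

/-- `ker θ` is prime (kernel of a ring map into a domain). -/
instance : (RingHom.ker (θ k)).IsPrime := RingHom.ker_isPrime _

/-- `R = k[z][x][y] / ker θ ≅ k[t², t³, z]`, a finitely generated domain over `k`. -/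
abbrev R := P k ⧸ RingHom.ker (θ k)

/-- The embedding `R ↪ k[z][t]`. -/
def ι : R k →+* B k := RingHom.kerLift (θ k)

/-- `ι : R ↪ k[z][t]` is injective. -/
theorem ι_injective : Function.Injective (ι k) := RingHom.kerLift_injective _

/-- `ι` on residue classes is `θ`. -/
@[simp] theorem ι_mk (q : P k) : ι k (Ideal.Quotient.mk _ q) = θ k q := rfl

example : IsDomain (R k) := inferInstance

/-- `R` is a finitely generated `k`-algebra (quotient of a polynomial ring). -/
instance : Algebra.FiniteType k (R k) := inferInstance

/-- `x`, `y`, `z` in `R`. -/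
def x : R k := Ideal.Quotient.mk _ (C X)
/-- `y ∈ R` (class of the variable `y`). -/
def y : R k := Ideal.Quotient.mk _ X
/-- `z - c ∈ R` for `c ∈ k`. -/
def zc (c : k) : R k := Ideal.Quotient.mk _ (C (C (X - C c)))

/-- `ι x = t²`. -/
@[simp] theorem ι_x : ι k (x k) = X ^ 2 := by simp [x, ι_mk, expand_X]
/-- `ι y = t³`. -/
@[simp] theorem ι_y : ι k (y k) = X ^ 3 := by simp [y, ι_mk]
/-- `ι (z - c) = z - c`. -/
@[simp] theorem ι_zc (c : k) : ι k (zc k c) = C (X - C c) := by simp [zc, ι_mk, expand_C]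

/-- A class vanishes in `R` iff `f = y² - x³` divides a representative. -/
theorem mk_eq_zero_iff (q : P k) : (Ideal.Quotient.mk (RingHom.ker (θ k)) q = 0) ↔ f k ∣ q := by
  rw [Ideal.Quotient.eq_zero_iff_mem, RingHom.mem_ker, θ_eq_zero_iff]

/-- `U = {s ∈ R : s(t = 0) ≠ 0 in k[z]}` = the complement of the prime `𝔮 = (x, y)` (the generic
point of the singular line). -/
def U : Submonoid (R k) where
  carrier := {s | (ι k s).coeff 0 ≠ 0}
  one_mem' := by simp
  mul_mem' := by
    intro a b ha hb
    simp only [Set.mem_setOf_eq, map_mul, mul_coeff_zero] at ha hb ⊢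
    exact mul_ne_zero ha hb

/-- Membership in `U`, unfolded. -/
theorem mem_U_iff (s : R k) : s ∈ U k ↔ (ι k s).coeff 0 ≠ 0 := Iff.rfl

/-- `0 ∉ U`. -/
theorem zero_notMem_U : (0 : R k) ∉ U k := by simp [mem_U_iff]

/-- `x ∉ U` (`x = t²` vanishes at `t = 0`): `U` misses the prime `(x, y)`. -/
theorem x_notMem_U : x k ∉ U k := by simp [mem_U_iff]

end CuspCylinder

end Summit.ResolutionOfSingularities.ResolutionOfSingularities.Theorems.Globalisation.Negative

end
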